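import Mathlib

/-!
# (M4a) ONE-ENDED AND (M4b) TWO-ENDED MEAN-SQUARE BOUNDS — plates t50-S of nsreg-p2 ROUND-47 «WHO HOLDS THE RIDGE»
(`r47/Sketch47.lean` sha16 c5b0bf755040b563, texts VERBATIM)

Width piece for crux `EulerZoomLiouville.PowerGaugeEulerLiouville` (stmt-NavierStokesRegularity-19832), by name under
LEAD 19832 (successor of ns-typeII-p2 g13) and planner nsreg-p2 g37; seat ns-ezl-w2 g5,
`--supports stmt-NavierStokesRegularity-19832 --as helper`.

Two of the ten free-standing S lemmas (1-D, in the log-radius variable `t = log(r/δ) ∈ [0,T]`) that price the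
circular means of the slice velocity at log-capacity rate (ROUND-47 §2):

* `oneEndedMeanSquare` = `NsregP2.R47.OneEndedMeanSquare` (M4a): for `v ∈ C¹([0,T]; ℂ)`,
  `(∫_0^T ‖v‖²)^{1/2} ≤ √T ‖v(T)‖ + (T/√2)(∫_0^T ‖v′‖²)^{1/2}`
  (`‖v(t)‖ ≤ ‖v(T)‖ + √(T−t)·(∫‖v′‖²)^{1/2}`, Minkowski in `L²[0,T]`, `∫_0^T (T−t) dt = T²/2`);
* `twoEndedMeanSquare` = `NsregP2.R47.TwoEndedMeanSquare` (M4b): for `w ∈ C¹([0,T]; ℝ)`, `T > 0`: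
  `(w(T)−w(0))²/T ≤ ∫ẇ²` and `(∫_0^T w²)^{1/2} ≤ √(T(w(0)²+w(0)w(T)+w(T)²)/3) + (T/2)(∫ẇ² − (w(T)−w(0))²/T)^{1/2}`
  (write `w = ℓ + φ`, `ℓ` linear with the same end values: `∫ẇ² = (w(T)−w(0))²/T + ∫φ̇²`, `∫ℓ² = T(…)/3`,
  `φ(t)² ≤ min(t, T−t)∫φ̇²`, `∫_0^T min = T²/4`, Minkowski).
(M5) `MarkovSelection` is the sibling file `…CondenserMarkovSelection`.

Tools (§0): Cauchy–Schwarz `(∫fg)² ≤ ∫f²∫g²` on an interval (discriminant argument) and the `L²[a,b]` triangle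
inequality `(∫(f+g)²)^{1/2} ≤ (∫f²)^{1/2} + (∫g²)^{1/2}`; the integral of an affine square.

HONEST FRAMING: elementary one-variable analysis on the MODEL lattice of crux E; proves nothing about the crux
(19832 OPEN), about `Sig.stub_selfSimilarC2Needle`, about THEOREM K⁗, or about Navier–Stokes regularity; no hard core is
touched. [folklore]
-/

noncomputable section

open Set Filter Topology Metric Function MeasureTheory Real

set_option linter.dupNamespace false

namespace Summit.NavierStokesRegularity.NavierStokesRegularity.Theorems.PowerGaugeEulerLiouville.Condenser

/-! ## §0 Tools: Cauchy–Schwarz, the `L²` triangle inequality and an affine square on an interval -/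

/-- **Cauchy–Schwarz on an interval**: `(∫_a^b f g)² ≤ (∫_a^b f²)(∫_a^b g²)` for `a ≤ b` (discriminant of the
non-negative quadratic `c ↦ ∫_a^b (c f + g)²`). [folklore] -/
theorem sq_integral_mul_le_of_intervalIntegrable {f g : ℝ → ℝ} {a b : ℝ} (hab : a ≤ b)
    (hf2 : IntervalIntegrable (fun t => f t ^ 2) volume a b)
    (hg2 : IntervalIntegrable (fun t => g t ^ 2) volume a b)
    (hfg : IntervalIntegrable (fun t => f t * g t) volume a b) :
    (∫ t in a..b, f t * g t) ^ 2 ≤ (∫ t in a..b, f t ^ 2) * (∫ t in a..b, g t ^ 2) := by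
  have key : ∀ c : ℝ, 0 ≤ (∫ t in a..b, f t ^ 2) * (c * c) + (2 * ∫ t in a..b, f t * g t) * c +
      ∫ t in a..b, g t ^ 2 := by
    intro c
    have h1 : ∫ t in a..b, (c * f t + g t) ^ 2 =
        ∫ t in a..b, (c ^ 2 * f t ^ 2 + 2 * c * (f t * g t) + g t ^ 2) :=
      intervalIntegral.integral_congr fun t _ => by ring
    have hsum : ∫ t in a..b, (c * f t + g t) ^ 2 =
        c ^ 2 * (∫ t in a..b, f t ^ 2) + 2 * c * (∫ t in a..b, f t * g t) + ∫ t in a..b, g t ^ 2 := by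
      rw [h1, intervalIntegral.integral_add ((hf2.const_mul _).add (hfg.const_mul _)) hg2,
        intervalIntegral.integral_add (hf2.const_mul _) (hfg.const_mul _),
        intervalIntegral.integral_const_mul, intervalIntegral.integral_const_mul]
    have h0 : 0 ≤ ∫ t in a..b, (c * f t + g t) ^ 2 :=
      intervalIntegral.integral_nonneg hab fun t _ => sq_nonneg _
    rw [hsum] at h0
    nlinarith [h0]
  have hd := discrim_le_zero key
  rw [discrim] at hd
  nlinarith [hd]

/-- **The `L²[a,b]` triangle inequality** (Minkowski for squares of real functions on an interval, `a ≤ b`):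
`(∫_a^b (f+g)²)^{1/2} ≤ (∫_a^b f²)^{1/2} + (∫_a^b g²)^{1/2}`. [folklore] -/
theorem sqrt_integral_add_sq_le {f g : ℝ → ℝ} {a b : ℝ} (hab : a ≤ b)
    (hf2 : IntervalIntegrable (fun t => f t ^ 2) volume a b)
    (hg2 : IntervalIntegrable (fun t => g t ^ 2) volume a b)
    (hfg : IntervalIntegrable (fun t => f t * g t) volume a b) :
    Real.sqrt (∫ t in a..b, (f t + g t) ^ 2) ≤
      Real.sqrt (∫ t in a..b, f t ^ 2) + Real.sqrt (∫ t in a..b, g t ^ 2) := by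
  set F := ∫ t in a..b, f t ^ 2 with hF
  set G := ∫ t in a..b, g t ^ 2 with hG
  set X := ∫ t in a..b, f t * g t with hX
  have hF0 : 0 ≤ F := intervalIntegral.integral_nonneg hab fun t _ => sq_nonneg _
  have hG0 : 0 ≤ G := intervalIntegral.integral_nonneg hab fun t _ => sq_nonneg _
  have hXX : X ^ 2 ≤ F * G := sq_integral_mul_le_of_intervalIntegrable hab hf2 hg2 hfg
  have hsum : ∫ t in a..b, (f t + g t) ^ 2 = F + 2 * X + G := by
    have h1 : ∫ t in a..b, (f t + g t) ^ 2 = ∫ t in a..b, (f t ^ 2 + 2 * (f t * g t) + g t ^ 2) :=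
      intervalIntegral.integral_congr fun t _ => by ring
    rw [h1, intervalIntegral.integral_add (hf2.add (hfg.const_mul _)) hg2,
      intervalIntegral.integral_add hf2 (hfg.const_mul _), intervalIntegral.integral_const_mul]
  have hXle : X ≤ Real.sqrt F * Real.sqrt G := by
    have h1 : X ^ 2 ≤ (Real.sqrt F * Real.sqrt G) ^ 2 := by
      rw [mul_pow, Real.sq_sqrt hF0, Real.sq_sqrt hG0]; exact hXX
    exact (abs_le_of_sq_le_sq' h1 (mul_nonneg (Real.sqrt_nonneg _) (Real.sqrt_nonneg _))).2
  rw [hsum]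
  calc Real.sqrt (F + 2 * X + G) ≤ Real.sqrt ((Real.sqrt F + Real.sqrt G) ^ 2) :=
        Real.sqrt_le_sqrt (by nlinarith [Real.sq_sqrt hF0, Real.sq_sqrt hG0])
    _ = Real.sqrt F + Real.sqrt G := Real.sqrt_sq (add_nonneg (Real.sqrt_nonneg _) (Real.sqrt_nonneg _))

/-- The integral of an affine square: `∫_a^b (c + k t)² dt = c²(b−a) + ck(b²−a²) + k²(b³−a³)/3`. [folklore] -/
theorem integral_affine_sq (c k a b : ℝ) :
    ∫ t in a..b, (c + k * t) ^ 2 = c ^ 2 * (b - a) + c * k * (b ^ 2 - a ^ 2) + k ^ 2 * (b ^ 3 - a ^ 3) / 3 := by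
  have h1 : ∫ t in a..b, (c + k * t) ^ 2 = ∫ t in a..b, (c ^ 2 + (2 * c * k) * t + k ^ 2 * t ^ 2) :=
    intervalIntegral.integral_congr fun t _ => by ring
  have hi1 : IntervalIntegrable (fun _ : ℝ => c ^ 2) volume a b := intervalIntegrable_const
  have hi2 : IntervalIntegrable (fun t : ℝ => (2 * c * k) * t) volume a b :=
    (continuous_const.mul continuous_id).intervalIntegrable _ _
  have hi3 : IntervalIntegrable (fun t : ℝ => k ^ 2 * t ^ 2) volume a b :=
    (continuous_const.mul (continuous_id.pow 2)).intervalIntegrable _ _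
  rw [h1, intervalIntegral.integral_add (hi1.add hi2) hi3, intervalIntegral.integral_add hi1 hi2,
    intervalIntegral.integral_const, intervalIntegral.integral_const_mul, intervalIntegral.integral_const_mul,
    integral_id, integral_pow, smul_eq_mul]
  push_cast
  ring

/-! ## (M4a) The one-ended mean-square bound -/

/-- **(M4a) ONE-ENDED MEAN-SQUARE BOUND**, working form.  For `v ∈ C¹([0,T]; ℂ)` (`0 ≤ T`):
`(∫_0^T ‖v‖²)^{1/2} ≤ √T ‖v(T)‖ + (T/√2)(∫_0^T ‖v′‖²)^{1/2}`.
Proof: `v(t) = v(T) − ∫_t^T v′`, so `‖v(t)‖ ≤ ‖v(T)‖ + √(T−t)·D` with `D² = ∫_0^T ‖v′‖²` (Cauchy–Schwarz); square,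
integrate, and use the `L²[0,T]` triangle inequality with `∫_0^T (√(T−t) D)² = D²T²/2`. [folklore] -/
theorem oneEndedMeanSquare_of {v v' : ℝ → ℂ} {T : ℝ} (hT : 0 ≤ T)
    (hv : ∀ t ∈ Icc 0 T, HasDerivAt v (v' t) t) (hv' : ContinuousOn v' (Icc 0 T)) :
    Real.sqrt (∫ t in (0 : ℝ)..T, ‖v t‖ ^ 2) ≤
      Real.sqrt T * ‖v T‖ + T / Real.sqrt 2 * Real.sqrt (∫ t in (0 : ℝ)..T, ‖v' t‖ ^ 2) := by
  set D2 := ∫ t in (0 : ℝ)..T, ‖v' t‖ ^ 2 with hD2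
  have hD2nn : 0 ≤ D2 := intervalIntegral.integral_nonneg hT fun t _ => sq_nonneg _
  set D := Real.sqrt D2 with hD
  have hD0 : 0 ≤ D := Real.sqrt_nonneg _
  set a := ‖v T‖ with ha
  have ha0 : 0 ≤ a := norm_nonneg _
  have hvc : ContinuousOn v (Icc 0 T) := fun t ht => (hv t ht).continuousAt.continuousWithinAt
  have hnc : ContinuousOn (fun t => ‖v' t‖) (Icc 0 T) := hv'.norm
  have hn2c : ContinuousOn (fun t => ‖v' t‖ ^ 2) (Icc 0 T) := hnc.pow 2
  -- pointwise bound
  have hpt : ∀ t ∈ Icc 0 T, ‖v t‖ ≤ a + Real.sqrt (T - t) * D := by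
    intro t ht
    have htT : t ≤ T := ht.2
    have hTt : 0 ≤ T - t := sub_nonneg.2 htT
    have hsub : uIcc t T ⊆ Icc 0 T := by rw [uIcc_of_le htT]; exact Icc_subset_Icc ht.1 le_rfl
    have hsub0 : uIcc 0 t ⊆ Icc 0 T := by rw [uIcc_of_le ht.1]; exact Icc_subset_Icc le_rfl htT
    have hint' : IntervalIntegrable v' volume t T := (hv'.mono hsub).intervalIntegrable
    have hftc : ∫ s in t..T, v' s = v T - v t :=
      intervalIntegral.integral_eq_sub_of_hasDerivAt (fun s hs => hv s (hsub hs)) hint'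
    have h1 : ‖v t‖ ≤ a + ‖∫ s in t..T, v' s‖ := by
      rw [hftc, ha]
      calc ‖v t‖ = ‖v T - (v T - v t)‖ := by rw [sub_sub_cancel]
        _ ≤ ‖v T‖ + ‖v T - v t‖ := norm_sub_le _ _
    have h2 : ‖∫ s in t..T, v' s‖ ≤ ∫ s in t..T, ‖v' s‖ :=
      intervalIntegral.norm_integral_le_integral_norm htT
    have hn_int : IntervalIntegrable (fun s => ‖v' s‖) volume t T := (hnc.mono hsub).intervalIntegrable
    have hn2_int : IntervalIntegrable (fun s => ‖v' s‖ ^ 2) volume t T := (hn2c.mono hsub).intervalIntegrable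
    have hn2_int0 : IntervalIntegrable (fun s => ‖v' s‖ ^ 2) volume 0 t := (hn2c.mono hsub0).intervalIntegrable
    have hCS := sq_integral_mul_le_of_intervalIntegrable (f := fun s => ‖v' s‖) (g := fun _ => (1 : ℝ)) htT
      hn2_int intervalIntegrable_const (hn_int.mul_const 1)
    have h1sq : ∫ _ in t..T, (1 : ℝ) ^ 2 = T - t := by simp
    have hmul1 : ∫ s in t..T, ‖v' s‖ * 1 = ∫ s in t..T, ‖v' s‖ := by simp
    rw [h1sq, hmul1] at hCS
    have hpart : ∫ s in t..T, ‖v' s‖ ^ 2 ≤ D2 := by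
      have hadd := intervalIntegral.integral_add_adjacent_intervals hn2_int0 hn2_int
      have h0 : 0 ≤ ∫ s in (0 : ℝ)..t, ‖v' s‖ ^ 2 := intervalIntegral.integral_nonneg ht.1 fun _ _ => sq_nonneg _
      rw [hD2]; linarith
    have h3 : ∫ s in t..T, ‖v' s‖ ≤ Real.sqrt (T - t) * D := by
      have h : (∫ s in t..T, ‖v' s‖) ^ 2 ≤ (Real.sqrt (T - t) * D) ^ 2 := by
        rw [mul_pow, Real.sq_sqrt hTt, hD, Real.sq_sqrt hD2nn]
        calc (∫ s in t..T, ‖v' s‖) ^ 2 ≤ (∫ s in t..T, ‖v' s‖ ^ 2) * (T - t) := hCS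
          _ ≤ D2 * (T - t) := mul_le_mul_of_nonneg_right hpart hTt
          _ = (T - t) * D2 := mul_comm _ _
      exact (abs_le_of_sq_le_sq' h (mul_nonneg (Real.sqrt_nonneg _) hD0)).2
    linarith [h1, h2, h3]
  -- integrate the squared pointwise bound
  have hgc : Continuous fun t : ℝ => Real.sqrt (T - t) * D :=
    (Real.continuous_sqrt.comp (continuous_const.sub continuous_id)).mul continuous_const
  have hv2_int : IntervalIntegrable (fun t => ‖v t‖ ^ 2) volume 0 T := by
    refine ((hvc.norm.pow 2).mono ?_).intervalIntegrable
    rw [uIcc_of_le hT]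
  have hmono : ∫ t in (0 : ℝ)..T, ‖v t‖ ^ 2 ≤ ∫ t in (0 : ℝ)..T, (a + Real.sqrt (T - t) * D) ^ 2 := by
    refine intervalIntegral.integral_mono_on hT hv2_int
      (((continuous_const.add hgc).pow 2).intervalIntegrable _ _) fun t ht => ?_
    exact pow_le_pow_left₀ (norm_nonneg _) (hpt t ht) 2
  -- the two pieces of the majorant
  have hA : Real.sqrt (∫ _ in (0 : ℝ)..T, a ^ 2) = Real.sqrt T * a := by
    rw [intervalIntegral.integral_const, smul_eq_mul, sub_zero, Real.sqrt_mul hT, Real.sqrt_sq ha0]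
  have hB : Real.sqrt (∫ t in (0 : ℝ)..T, (Real.sqrt (T - t) * D) ^ 2) = T / Real.sqrt 2 * D := by
    have h1 : ∫ t in (0 : ℝ)..T, (Real.sqrt (T - t) * D) ^ 2 = ∫ t in (0 : ℝ)..T, (D ^ 2 * T - D ^ 2 * t) := by
      refine intervalIntegral.integral_congr fun t ht => ?_
      rw [uIcc_of_le hT] at ht
      show (Real.sqrt (T - t) * D) ^ 2 = D ^ 2 * T - D ^ 2 * t
      rw [mul_pow, Real.sq_sqrt (sub_nonneg.2 ht.2)]; ring
    have h2 : ∫ t in (0 : ℝ)..T, (D ^ 2 * T - D ^ 2 * t) = (T / Real.sqrt 2 * D) ^ 2 := by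
      rw [intervalIntegral.integral_sub, intervalIntegral.integral_const, intervalIntegral.integral_const_mul,
        integral_id, smul_eq_mul, mul_pow, div_pow, Real.sq_sqrt (by norm_num : (0 : ℝ) ≤ 2)]
      · ring
      · exact intervalIntegrable_const
      · exact (continuous_const.mul continuous_id).intervalIntegrable _ _
    rw [h1, h2, Real.sqrt_sq (by positivity)]
  -- Minkowski
  have hfa : IntervalIntegrable (fun _ : ℝ => a ^ 2) volume 0 T := intervalIntegrable_const
  have hgg : IntervalIntegrable (fun t : ℝ => (Real.sqrt (T - t) * D) ^ 2) volume 0 T :=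
    (hgc.pow 2).intervalIntegrable _ _
  have hfg : IntervalIntegrable (fun t : ℝ => a * (Real.sqrt (T - t) * D)) volume 0 T :=
    (continuous_const.mul hgc).intervalIntegrable _ _
  have hM := sqrt_integral_add_sq_le (f := fun _ => a) (g := fun t => Real.sqrt (T - t) * D) hT hfa hgg hfg
  rw [hA, hB] at hM
  exact (Real.sqrt_le_sqrt hmono).trans hM

/-- **(M4a) `NsregP2.R47.OneEndedMeanSquare`, binder-for-binder** (Sketch47 of nsreg-p2 g37, plate t50-M4a).
Use in ROUND-47 (the RETURN): `v = ` circular mean of `V_⊥` in the log-radius variable, `T = log(d/δ)`, `v(T) ≈ 0` at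
the returned radius; with (M2) `∫|v₀|² dt ≤ (T²/2)(2π)⁻¹𝓔_block(radial means)`. [folklore] -/
theorem oneEndedMeanSquare :
    ∀ (v v' : ℝ → ℂ) (T : ℝ), 0 ≤ T →
      (∀ t ∈ Icc 0 T, HasDerivAt v (v' t) t) → ContinuousOn v' (Icc 0 T) →
      Real.sqrt (∫ t in (0 : ℝ)..T, ‖v t‖ ^ 2) ≤
        Real.sqrt T * ‖v T‖ + T / Real.sqrt 2 * Real.sqrt (∫ t in (0 : ℝ)..T, ‖v' t‖ ^ 2) :=
  fun _ _ _ hT hv hv' => oneEndedMeanSquare_of hT hv hv'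

/-! ## (M4b) The two-ended mean-square bound -/

/-- **(M4b) TWO-ENDED MEAN-SQUARE BOUND**, working form.  For `w ∈ C¹([0,T]; ℝ)`, `T > 0`:
`(w(T)−w(0))²/T ≤ ∫_0^T ẇ²` and
`(∫_0^T w²)^{1/2} ≤ √(T(w(0)²+w(0)w(T)+w(T)²)/3) + (T/2)·(∫_0^T ẇ² − (w(T)−w(0))²/T)^{1/2}`.
Proof: `w = ℓ + φ` with `ℓ(t) = w(0) + kt`, `k = (w(T)−w(0))/T`, `φ(0) = φ(T) = 0`; `∫(ẇ − k)² = ∫ẇ² − k²T ≥ 0`;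
`∫ℓ² = T(w(0)²+w(0)w(T)+w(T)²)/3`; `φ(t)² ≤ t∫φ̇²` and `φ(t)² ≤ (T−t)∫φ̇²` (Cauchy–Schwarz from either end), so
`∫_0^{T/2}φ² + ∫_{T/2}^Tφ² ≤ (T²/8 + T²/8)∫φ̇²`; Minkowski. [folklore] -/
theorem twoEndedMeanSquare_of {w w' : ℝ → ℝ} {T : ℝ} (hT : 0 < T)
    (hw : ∀ t ∈ Icc 0 T, HasDerivAt w (w' t) t) (hw' : ContinuousOn w' (Icc 0 T)) :
    (w T - w 0) ^ 2 / T ≤ ∫ t in (0 : ℝ)..T, w' t ^ 2 ∧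
      Real.sqrt (∫ t in (0 : ℝ)..T, w t ^ 2) ≤
        Real.sqrt (T * (w 0 ^ 2 + w 0 * w T + w T ^ 2) / 3) +
          T / 2 * Real.sqrt ((∫ t in (0 : ℝ)..T, w' t ^ 2) - (w T - w 0) ^ 2 / T) := by
  have hT0 : 0 ≤ T := hT.le
  set k := (w T - w 0) / T with hk
  have hkT : k * T = w T - w 0 := by rw [hk]; field_simp
  -- the linear part and the bridge
  set φ : ℝ → ℝ := fun t => w t - (w 0 + k * t) with hφ
  have hφ0 : φ 0 = 0 := by simp [hφ]
  have hφT : φ T = 0 := by simp only [hφ]; linarith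
  have hφd : ∀ t ∈ Icc 0 T, HasDerivAt φ (w' t - k) t := fun t ht => by
    have hl : HasDerivAt (fun t : ℝ => w 0 + k * t) k t := by
      simpa using ((hasDerivAt_id t).const_mul k).const_add (w 0)
    exact (hw t ht).sub hl
  have hwc : ContinuousOn w (Icc 0 T) := fun t ht => (hw t ht).continuousAt.continuousWithinAt
  have hφc : ContinuousOn φ (Icc 0 T) := hwc.sub (continuousOn_const.add (continuousOn_const.mul continuousOn_id))
  have hφ'c : ContinuousOn (fun t => w' t - k) (Icc 0 T) := hw'.sub continuousOn_const
  have hφ'2c : ContinuousOn (fun t => (w' t - k) ^ 2) (Icc 0 T) := hφ'c.pow 2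
  have hIcc : uIcc 0 T = Icc 0 T := uIcc_of_le hT0
  -- ∫ w' = w T - w 0
  have hw'i : IntervalIntegrable w' volume 0 T := (hw'.mono hIcc.le).intervalIntegrable
  have hFTC : ∫ t in (0 : ℝ)..T, w' t = w T - w 0 :=
    intervalIntegral.integral_eq_sub_of_hasDerivAt (fun t ht => hw t (hIcc ▸ ht)) hw'i
  -- Φ := ∫ φ'² = ∫ w'² - (w T - w 0)²/T
  set Φ := ∫ t in (0 : ℝ)..T, (w' t - k) ^ 2 with hΦdef
  have hw'2i : IntervalIntegrable (fun t => w' t ^ 2) volume 0 T := ((hw'.pow 2).mono hIcc.le).intervalIntegrable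
  have hΦ : Φ = (∫ t in (0 : ℝ)..T, w' t ^ 2) - (w T - w 0) ^ 2 / T := by
    have h1 : Φ = ∫ t in (0 : ℝ)..T, (w' t ^ 2 - (2 * k) * w' t + k ^ 2) := by
      rw [hΦdef]; exact intervalIntegral.integral_congr fun t _ => by ring
    rw [h1, intervalIntegral.integral_add (hw'2i.sub (hw'i.const_mul _)) intervalIntegrable_const,
      intervalIntegral.integral_sub hw'2i (hw'i.const_mul _), intervalIntegral.integral_const_mul, hFTC,
      intervalIntegral.integral_const, smul_eq_mul, sub_zero]
    have : (w T - w 0) ^ 2 / T = k * (w T - w 0) := by rw [hk]; field_simp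
    rw [this]
    linear_combination k * hkT
  have hΦ0 : 0 ≤ Φ := intervalIntegral.integral_nonneg hT0 fun t _ => sq_nonneg _
  refine ⟨by linarith [hΦ, hΦ0], ?_⟩
  -- pointwise bridge bounds
  have hφ'i_sub : ∀ {s u : ℝ}, 0 ≤ s → s ≤ u → u ≤ T →
      IntervalIntegrable (fun t => w' t - k) volume s u ∧ IntervalIntegrable (fun t => (w' t - k) ^ 2) volume s u :=
    fun {s u} hs hsu hu => by
      have hsub : uIcc s u ⊆ Icc 0 T := by rw [uIcc_of_le hsu]; exact Icc_subset_Icc hs hu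
      exact ⟨(hφ'c.mono hsub).intervalIntegrable, (hφ'2c.mono hsub).intervalIntegrable⟩
  have hleft : ∀ t ∈ Icc 0 T, φ t ^ 2 ≤ t * Φ := by
    intro t ht
    have hsub : uIcc 0 t ⊆ Icc 0 T := by rw [uIcc_of_le ht.1]; exact Icc_subset_Icc le_rfl ht.2
    obtain ⟨hi1, hi2⟩ := hφ'i_sub le_rfl ht.1 ht.2
    have hftc : ∫ s in (0 : ℝ)..t, (w' s - k) = φ t - φ 0 :=
      intervalIntegral.integral_eq_sub_of_hasDerivAt (fun s hs => hφd s (hsub hs)) hi1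
    rw [hφ0, sub_zero] at hftc
    have hCS := sq_integral_mul_le_of_intervalIntegrable (f := fun s => w' s - k) (g := fun _ => (1 : ℝ)) ht.1
      hi2 intervalIntegrable_const (hi1.mul_const 1)
    simp only [mul_one, one_pow, intervalIntegral.integral_const, smul_eq_mul, sub_zero] at hCS
    rw [hftc] at hCS
    have hpart : ∫ s in (0 : ℝ)..t, (w' s - k) ^ 2 ≤ Φ := by
      obtain ⟨_, hj2⟩ := hφ'i_sub ht.1 ht.2 le_rfl
      have hadd := intervalIntegral.integral_add_adjacent_intervals hi2 hj2
      have h0 : 0 ≤ ∫ s in t..T, (w' s - k) ^ 2 := intervalIntegral.integral_nonneg ht.2 fun _ _ => sq_nonneg _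
      rw [hΦdef]; linarith
    calc φ t ^ 2 ≤ (∫ s in (0 : ℝ)..t, (w' s - k) ^ 2) * t := by linarith [hCS]
      _ ≤ Φ * t := mul_le_mul_of_nonneg_right hpart ht.1
      _ = t * Φ := mul_comm _ _
  have hright : ∀ t ∈ Icc 0 T, φ t ^ 2 ≤ (T - t) * Φ := by
    intro t ht
    have hTt : 0 ≤ T - t := sub_nonneg.2 ht.2
    have hsub : uIcc t T ⊆ Icc 0 T := by rw [uIcc_of_le ht.2]; exact Icc_subset_Icc ht.1 le_rfl
    obtain ⟨hi1, hi2⟩ := hφ'i_sub ht.1 ht.2 le_rfl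
    have hftc : ∫ s in t..T, (w' s - k) = φ T - φ t :=
      intervalIntegral.integral_eq_sub_of_hasDerivAt (fun s hs => hφd s (hsub hs)) hi1
    rw [hφT, zero_sub] at hftc
    have hCS := sq_integral_mul_le_of_intervalIntegrable (f := fun s => w' s - k) (g := fun _ => (1 : ℝ)) ht.2
      hi2 intervalIntegrable_const (hi1.mul_const 1)
    simp only [mul_one, one_pow, intervalIntegral.integral_const, smul_eq_mul] at hCS
    rw [hftc, neg_sq] at hCS
    have hpart : ∫ s in t..T, (w' s - k) ^ 2 ≤ Φ := by
      obtain ⟨_, hj2⟩ := hφ'i_sub le_rfl ht.1 ht.2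
      have hadd := intervalIntegral.integral_add_adjacent_intervals hj2 hi2
      have h0 : 0 ≤ ∫ s in (0 : ℝ)..t, (w' s - k) ^ 2 := intervalIntegral.integral_nonneg ht.1 fun _ _ => sq_nonneg _
      rw [hΦdef]; linarith
    calc φ t ^ 2 ≤ (∫ s in t..T, (w' s - k) ^ 2) * (T - t) := by linarith [hCS]
      _ ≤ Φ * (T - t) := mul_le_mul_of_nonneg_right hpart hTt
      _ = (T - t) * Φ := mul_comm _ _
  -- ∫ φ² ≤ Φ T²/4
  have hφ2c : ContinuousOn (fun t => φ t ^ 2) (Icc 0 T) := hφc.pow 2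
  have hT2 : 0 ≤ T / 2 := by linarith
  have hT2T : T / 2 ≤ T := by linarith
  have hφ2i1 : IntervalIntegrable (fun t => φ t ^ 2) volume 0 (T / 2) := by
    refine (hφ2c.mono ?_).intervalIntegrable; rw [uIcc_of_le hT2]; exact Icc_subset_Icc le_rfl hT2T
  have hφ2i2 : IntervalIntegrable (fun t => φ t ^ 2) volume (T / 2) T := by
    refine (hφ2c.mono ?_).intervalIntegrable; rw [uIcc_of_le hT2T]; exact Icc_subset_Icc hT2 le_rfl
  have hI1 : ∫ t in (0 : ℝ)..(T / 2), φ t ^ 2 ≤ Φ * (T ^ 2 / 8) := by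
    calc ∫ t in (0 : ℝ)..(T / 2), φ t ^ 2 ≤ ∫ t in (0 : ℝ)..(T / 2), t * Φ :=
          intervalIntegral.integral_mono_on hT2 hφ2i1 ((continuous_id.mul continuous_const).intervalIntegrable _ _)
            fun t ht => hleft t ⟨ht.1, ht.2.trans hT2T⟩
      _ = Φ * (T ^ 2 / 8) := by rw [intervalIntegral.integral_mul_const, integral_id]; ring
  have hI2 : ∫ t in (T / 2)..T, φ t ^ 2 ≤ Φ * (T ^ 2 / 8) := by
    calc ∫ t in (T / 2)..T, φ t ^ 2 ≤ ∫ t in (T / 2)..T, (T - t) * Φ :=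
          intervalIntegral.integral_mono_on hT2T hφ2i2
            (((continuous_const.sub continuous_id).mul continuous_const).intervalIntegrable _ _)
            fun t ht => hright t ⟨hT2.trans ht.1, ht.2⟩
      _ = Φ * (T ^ 2 / 8) := by
          rw [intervalIntegral.integral_mul_const, intervalIntegral.integral_sub, intervalIntegral.integral_const,
            integral_id, smul_eq_mul]
          · ring
          · exact intervalIntegrable_const
          · exact continuous_id.intervalIntegrable _ _
  have hφ2 : ∫ t in (0 : ℝ)..T, φ t ^ 2 ≤ Φ * (T ^ 2 / 4) := by
    rw [← intervalIntegral.integral_add_adjacent_intervals hφ2i1 hφ2i2]; linarith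
  -- ∫ ℓ²
  have hℓ2 : ∫ t in (0 : ℝ)..T, (w 0 + k * t) ^ 2 = T * (w 0 ^ 2 + w 0 * w T + w T ^ 2) / 3 := by
    rw [integral_affine_sq]
    have hwT : w T = w 0 + k * T := by linarith
    rw [hwT]; ring
  -- Minkowski
  have hℓ2i : IntervalIntegrable (fun t : ℝ => (w 0 + k * t) ^ 2) volume 0 T :=
    ((continuous_const.add (continuous_const.mul continuous_id)).pow 2).intervalIntegrable _ _
  have hφ2i : IntervalIntegrable (fun t => φ t ^ 2) volume 0 T := (hφ2c.mono hIcc.le).intervalIntegrable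
  have hℓφi : IntervalIntegrable (fun t : ℝ => (w 0 + k * t) * φ t) volume 0 T :=
    (((continuousOn_const.add (continuousOn_const.mul continuousOn_id)).mul hφc).mono hIcc.le).intervalIntegrable
  have hM := sqrt_integral_add_sq_le (f := fun t : ℝ => w 0 + k * t) (g := φ) hT0 hℓ2i hφ2i hℓφi
  have hwsum : ∫ t in (0 : ℝ)..T, w t ^ 2 = ∫ t in (0 : ℝ)..T, ((w 0 + k * t) + φ t) ^ 2 :=
    intervalIntegral.integral_congr fun t _ => by simp [hφ]
  rw [← hwsum, hℓ2] at hM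
  refine hM.trans (add_le_add_right ?_ _)
  rw [← hΦ]
  calc Real.sqrt (∫ t in (0 : ℝ)..T, φ t ^ 2) ≤ Real.sqrt (Φ * (T ^ 2 / 4)) := Real.sqrt_le_sqrt hφ2
    _ = T / 2 * Real.sqrt Φ := by
        rw [Real.sqrt_mul hΦ0, show T ^ 2 / 4 = (T / 2) ^ 2 by ring, Real.sqrt_sq hT2]; ring

/-- **(M4b) `NsregP2.R47.TwoEndedMeanSquare`, binder-for-binder** (Sketch47 of nsreg-p2 g37, plate t50-M4b).
Use in ROUND-47: `w(t) = γs + ⨍_{S_{δe^t}} V_e` runs from `−(γ′−γ)s` (the hit) to `≈ γs` (returned); the first conjunct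
is the column's log-capacity, the second the bound `𝓦̃ ≤ √((γ²−γx+x²)/3) + ½√(σ/2)` of the memo. [folklore] -/
theorem twoEndedMeanSquare :
    ∀ (w w' : ℝ → ℝ) (T : ℝ), 0 < T →
      (∀ t ∈ Icc 0 T, HasDerivAt w (w' t) t) → ContinuousOn w' (Icc 0 T) →
      (w T - w 0) ^ 2 / T ≤ ∫ t in (0 : ℝ)..T, w' t ^ 2 ∧
        Real.sqrt (∫ t in (0 : ℝ)..T, w t ^ 2) ≤
          Real.sqrt (T * (w 0 ^ 2 + w 0 * w T + w T ^ 2) / 3) +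
            T / 2 * Real.sqrt ((∫ t in (0 : ℝ)..T, w' t ^ 2) - (w T - w 0) ^ 2 / T) :=
  fun _ _ _ hT hw hw' => twoEndedMeanSquare_of hT hw hw'

end Summit.NavierStokesRegularity.NavierStokesRegularity.Theorems.PowerGaugeEulerLiouville.Condenser

end
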